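import Summits.KontsevichZagierPeriods.KontsevichZagierPeriods.Theorems.SoloBlindZetaTwo
import HarnessLib

/-!
# `ζ(2) = π²/6` inside the three rules, IV: the unit square and the tame `π`-sector

Two complements to `SoloBlindZetaTwo`.

1. **The unit-square form.**  The most familiar period representation of `ζ(2)`,
   `S = [(0,1)², 1/(1-xy)]`, is carried onto Kontsevich–Zagier's iterated-integral form
   `Z = [{0<u<y<1}, 1/((1-u)y)]` by ONE rational change of variables, the product chart
   `(x,y) ↦ (xy, y)` (`exists_productChart`, `equivalent_unitSquare_zetaTwo`); hence
   `kz_zeta_two_square : Equivalent unitSquareRep piSqSixthRep` and `value S = π²/6`, again with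
   absolute convergence imported along the chart rather than computed.

2. **The tame `π`-sector.**  The set `piSector` of all formal combinations of representations whose
   class in `Q = FormalRep ⧸ relations` lies in the polynomial algebra `ℚ̄[x_π]`
   (`x_π = 4·[(0,1), 1/(1+t²)]`, `evalQ x_π = π`) is a subring of `FormalRep` containing the
   relations, every rational representation of dimension `≤ 1` with value in `ℚ̄ + ℚ̄π`,
   and — by the theorems of this series — `Z` and `S`.  On it the Kontsevich–Zagier conjecture holds
   unconditionally (`piSector_kernel`, `kz_piSector`): this is the invariant form of the principle
   "every accessible identity proved inside the rules enlarges the unconditional sector".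

References: M. Kontsevich, D. Zagier, *Periods* (2001), §1.1–§1.2; F. Beukers, *A note on the
irrationality of ζ(2) and ζ(3)*, Bull. LMS 11 (1979) (the unit-square integrals).
-/

noncomputable section

namespace Summit.KontsevichZagierPeriods.KontsevichZagierPeriods.Theorems

open Set MeasureTheory
open Literature.ModelTheory.ExponentialFields (IsSemialgebraic)
open Literature.NumberTheory.Transcendental
open Literature.NumberTheory.Transcendental.KZ

namespace SoloBlind

/-! ## The open unit square and the product chart -/

/-- The open unit square `{0<x<1, 0<y<1}`. -/
def kzUnitSquare : Set (Fin 2 → ℝ) := {z | 0 < z 0 ∧ z 0 < 1 ∧ 0 < z 1 ∧ z 1 < 1}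

/-- Membership in the unit square, unfolded. -/
theorem mem_kzUnitSquare {z : Fin 2 → ℝ} :
    z ∈ kzUnitSquare ↔ 0 < z 0 ∧ z 0 < 1 ∧ 0 < z 1 ∧ z 1 < 1 := Iff.rfl

/-- The unit square is `ℚ`-semialgebraic. -/
theorem isSemialgebraic_kzUnitSquare : IsSemialgebraic ℚ kzUnitSquare := by
  have h := isSemialgebraic_setOf_forall_aeval_pos
    ![MvPolynomial.X 0, 1 - MvPolynomial.X 0, MvPolynomial.X 1,
      (1 - MvPolynomial.X 1 : MvPolynomial (Fin 2) ℚ)]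
  convert h using 1
  ext x
  simp only [kzUnitSquare, mem_setOf_eq, Fin.forall_fin_succ, Matrix.cons_val_zero,
    Matrix.cons_val_succ, MvPolynomial.aeval_X, map_sub, map_one, sub_pos]
  exact ⟨fun ⟨h0, h1, h2, h3⟩ => ⟨h0, h1, h2, h3, fun i => Fin.elim0 i⟩,
    fun ⟨h0, h1, h2, h3, _⟩ => ⟨h0, h1, h2, h3⟩⟩

/-- The unit square is measurable. -/
theorem measurableSet_kzUnitSquare : MeasurableSet kzUnitSquare :=
  isSemialgebraic_kzUnitSquare.measurableSet_holds

/-- **The product chart** `Φ(x,y) = (xy, y)`: a `ℚ`-polynomial map of the unit square ONTO the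
triangle `T = {0<u<y<1}`, injective, with `|det DΦ| = y`. -/
theorem exists_productChart :
    ∃ (Φ : (Fin 2 → ℝ) → (Fin 2 → ℝ)) (Φ' : (Fin 2 → ℝ) → (Fin 2 → ℝ) →L[ℝ] (Fin 2 → ℝ)),
      (∀ z, Φ z 0 = z 0 * z 1) ∧ (∀ z, Φ z 1 = z 1) ∧
      IsSemialgebraicMapOn ℚ kzUnitSquare Φ ∧ (∀ z ∈ kzUnitSquare, HasFDerivAt Φ (Φ' z) z) ∧
      InjOn Φ kzUnitSquare ∧ Φ '' kzUnitSquare = kzTriangle ∧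
      (∀ z ∈ kzUnitSquare, |(Φ' z).det| = z 1) := by
  set Φ : (Fin 2 → ℝ) → (Fin 2 → ℝ) := fun z => ![z 0 * z 1, z 1] with hΦ
  set Φ' : (Fin 2 → ℝ) → (Fin 2 → ℝ) →L[ℝ] (Fin 2 → ℝ) :=
    fun z => LinearMap.toContinuousLinearMap (Matrix.toLin' !![z 1, z 0; 0, 1]) with hΦ'
  have hΦ0 : ∀ z, Φ z 0 = z 0 * z 1 := fun z => rfl
  have hΦ1 : ∀ z, Φ z 1 = z 1 := fun z => rfl
  have hΦ'0 : ∀ z v : Fin 2 → ℝ, Φ' z v 0 = z 1 * v 0 + z 0 * v 1 := by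
    intro z v
    change Matrix.toLin' !![z 1, z 0; 0, 1] v 0 = _
    rw [Matrix.toLin'_apply]
    simp [Matrix.mulVec, dotProduct, Fin.sum_univ_two]
  have hΦ'1 : ∀ z v : Fin 2 → ℝ, Φ' z v 1 = v 1 := by
    intro z v
    change Matrix.toLin' !![z 1, z 0; 0, 1] v 1 = _
    rw [Matrix.toLin'_apply]
    simp [Matrix.mulVec, dotProduct, Fin.sum_univ_two]
  have hdet : ∀ z, (Φ' z).det = z 1 := by
    intro z
    change LinearMap.det (Matrix.toLin' !![z 1, z 0; 0, 1]) = _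
    rw [LinearMap.det_toLin', Matrix.det_fin_two]
    simp only [Matrix.of_apply, Matrix.cons_val', Matrix.cons_val_zero, Matrix.cons_val_one,
      Matrix.cons_val_fin_one, Matrix.empty_val']
    ring
  have hderiv : ∀ z, HasFDerivAt Φ (Φ' z) z := by
    intro z
    have h0 : HasFDerivAt (fun y : Fin 2 → ℝ => y 0)
        (ContinuousLinearMap.proj (R := ℝ) (φ := fun _ : Fin 2 => ℝ) 0) z := hasFDerivAt_apply 0 z
    have h1 : HasFDerivAt (fun y : Fin 2 → ℝ => y 1)
        (ContinuousLinearMap.proj (R := ℝ) (φ := fun _ : Fin 2 => ℝ) 1) z := hasFDerivAt_apply 1 z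
    rw [hasFDerivAt_pi']
    refine Fin.forall_fin_two.mpr ⟨?_, ?_⟩
    · have hf : (fun y : Fin 2 → ℝ => Φ y 0) = fun y => y 0 * y 1 := funext fun y => by rw [hΦ0]
      rw [hf]
      refine (h0.mul h1).congr_fderiv (ContinuousLinearMap.ext fun v => ?_)
      simp [hΦ'0]
      ring
    · have hf : (fun y : Fin 2 → ℝ => Φ y 1) = fun y => y 1 := funext fun y => by rw [hΦ1]
      rw [hf]
      refine h1.congr_fderiv (ContinuousLinearMap.ext fun v => ?_)
      simp [hΦ'1]
  refine ⟨Φ, Φ', hΦ0, hΦ1, ?_, fun z _ => hderiv z, ?_, ?_, fun z hz => ?_⟩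
  · convert isSemialgebraicMapOn_aeval isSemialgebraic_kzUnitSquare
      ![MvPolynomial.X 0 * MvPolynomial.X 1, (MvPolynomial.X 1 : MvPolynomial (Fin 2) ℚ)]
      using 2 with z
    funext i
    fin_cases i
    · simp [hΦ0]
    · simp [hΦ1]
  · intro x hx y hy hxy
    have e0 := congrFun hxy 0
    have e1 := congrFun hxy 1
    simp only [hΦ0, hΦ1] at e0 e1
    rw [mem_kzUnitSquare] at hx
    rw [e1] at e0
    have h0 : x 0 = y 0 := mul_right_cancel₀ hy.2.2.1.ne' e0
    funext i
    fin_cases i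
    · exact h0
    · exact e1
  · ext w
    constructor
    · rintro ⟨z, hz, rfl⟩
      rw [mem_kzUnitSquare] at hz
      rw [mem_kzTriangle]
      obtain ⟨h0, h01, h1, h11⟩ := hz
      simp only [hΦ0, hΦ1]
      exact ⟨mul_pos h0 h1, by nlinarith, h11⟩
    · intro hw
      rw [mem_kzTriangle] at hw
      obtain ⟨hw0, hw01, hw1⟩ := hw
      have hw1' : 0 < w 1 := hw0.trans hw01
      refine ⟨![w 0 / w 1, w 1], ?_, ?_⟩
      · rw [mem_kzUnitSquare]
        exact ⟨div_pos hw0 hw1', (div_lt_one hw1').mpr hw01, hw1', hw1⟩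
      · funext i
        fin_cases i
        · change w 0 / w 1 * w 1 = w 0
          exact div_mul_cancel₀ (w 0) hw1'.ne'
        · rfl
  · rw [mem_kzUnitSquare] at hz
    rw [hdet]
    exact abs_of_pos hz.2.2.1

/-! ## `S = [(0,1)², 1/(1-xy)]` -/

/-- **`1/(1-xy)` is absolutely integrable on the unit square** — imported along the product chart
from the integrability of Kontsevich–Zagier's `1/((1-u)y)` on the triangle. -/
theorem integrableOn_unitSquare :
    IntegrableOn (fun z : Fin 2 → ℝ => 1 / (1 - z 0 * z 1)) kzUnitSquare := by
  obtain ⟨Φ, Φ', hΦ0, hΦ1, -, hderiv, hinj, himage, hdet⟩ := exists_productChart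
  have h := integrableOn_zetaTwo_triangle
  rw [← himage] at h
  refine (integrableOn_iff_of_chart measurableSet_kzUnitSquare hderiv hinj hdet
    (f := fun z : Fin 2 → ℝ => 1 / (1 - z 0 * z 1))
    (g := fun w : Fin 2 → ℝ => 1 / ((1 - w 0) * w 1)) fun z hz => ?_).mp h
  simp only [hΦ0, hΦ1]
  rw [mem_kzUnitSquare] at hz
  have h1 : z 1 ≠ 0 := hz.2.2.1.ne'
  have h2 : 1 - z 0 * z 1 ≠ 0 := by nlinarith [hz.1, hz.2.1, hz.2.2.1, hz.2.2.2]
  field_simp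

/-- **`S = [(0,1)², 1/(1-xy)]`**, the unit-square representation of `ζ(2)`. -/
def unitSquareRep : IntegralRep 2 :=
  ratRep kzUnitSquare (fun z => 1 / (1 - z 0 * z 1)) 1 (1 - MvPolynomial.X 0 * MvPolynomial.X 1)
    isSemialgebraic_kzUnitSquare
    (fun z hz => by
      rw [mem_kzUnitSquare] at hz
      simp only [map_mul, map_sub, map_one, MvPolynomial.aeval_X]
      nlinarith [hz.1, hz.2.1, hz.2.2.1, hz.2.2.2])
    (fun z _ => by simp) integrableOn_unitSquare

/-- `S` has KZ's literal rational shape. -/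
theorem isRational_unitSquareRep : unitSquareRep.IsRational := isRational_ratRep

/-- **One move**: the product chart `(x,y) ↦ (xy,y)` carries `S` onto Kontsevich–Zagier's `Z`,
`1/(1-xy) = (1/((1-u)y))·|y|` with `u = xy`. -/
theorem equivalent_unitSquare_zetaTwo : Equivalent unitSquareRep zetaTwoRep := by
  obtain ⟨Φ, Φ', hΦ0, hΦ1, hsa, hderiv, hinj, himage, hdet⟩ := exists_productChart
  refine equivalent_of_chart hsa hderiv hinj himage hdet
    (f := fun z : Fin 2 → ℝ => 1 / (1 - z 0 * z 1))
    (g := fun w : Fin 2 → ℝ => 1 / ((1 - w 0) * w 1)) (fun z hz => ?_)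
    rfl (fun _ _ => rfl) rfl (fun _ _ => rfl)
  simp only [hΦ0, hΦ1]
  rw [mem_kzUnitSquare] at hz
  have h1 : z 1 ≠ 0 := hz.2.2.1.ne'
  have h2 : 1 - z 0 * z 1 ≠ 0 := by nlinarith [hz.1, hz.2.1, hz.2.2.1, hz.2.2.2]
  field_simp

/-- **`∬_{(0,1)²} dxdy/(1-xy)` vs `π²/6`, inside the rules**: `S` and `R` are equivalent under
finitely many additivity and rational change-of-variables moves. -/
theorem kz_zeta_two_square : Equivalent unitSquareRep piSqSixthRep :=
  equivalent_unitSquare_zetaTwo.trans kz_zeta_two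

/-- `value S = π²/6`, move-theoretically. -/
theorem unitSquareRep_value : unitSquareRep.value = Real.pi ^ 2 / 6 := by
  rw [← piSqSixthRep_value]
  exact Equivalent.value_eq_holds kz_zeta_two_square

/-! ## The tame `π`-sector -/

/-- The class `x_π = 4·[(0,1), 1/(1+t²)]` in `Q`, with `evalQ x_π = π`. -/
def xPi : Q := (4 : K₀) • alpha 1

/-- `evalQ x_π = π`. -/
theorem evalQ_xPi : evalQ xPi = Real.pi := evalQ_four_smul_alpha_one

/-- `x_π` lies in the cell span. -/
theorem xPi_mem_cellSpan : xPi ∈ cellSpan :=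
  Submodule.smul_mem _ _ (alpha_mem_cellSpan isAlgebraic_one one_pos)

/-- **The tame `π`-sector** `M_π`: all formal `ℤ`-combinations of integral representations whose
class modulo the moves is a `ℚ̄`-polynomial in `x_π`.  It is a subring of `FormalRep`. -/
def piSector : NonUnitalSubring FormalRep where
  carrier := {z | mkQ z ∈ Algebra.adjoin K₀ {xPi}}
  zero_mem' := by
    simp only [mem_setOf_eq, map_zero]
    exact zero_mem _
  add_mem' := fun ha hb => by
    simp only [mem_setOf_eq, map_add]
    exact add_mem ha hb
  neg_mem' := fun ha => by
    simp only [mem_setOf_eq, map_neg]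
    exact neg_mem ha
  mul_mem' := fun ha hb => by
    simp only [mem_setOf_eq, mkQ_mul]
    exact mul_mem ha hb

/-- Membership in `M_π`, unfolded. -/
theorem mem_piSector {z : FormalRep} : z ∈ piSector ↔ mkQ z ∈ Algebra.adjoin K₀ {xPi} := Iff.rfl

/-- Every relation lies in `M_π` (its class is `0`). -/
theorem relations_le_piSector {z : FormalRep} (hz : z ∈ relations) : z ∈ piSector := by
  rw [mem_piSector, mkQ_eq_zero_iff.mpr hz]
  exact zero_mem _

/-- The rank-one ring `B(π)` lies in `M_π`. -/
theorem lineRing_pi_le_piSector : lineRing Real.pi ≤ piSector := fun _ hz =>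
  mkQ_mem_of_mem_closure
    (fun _ hg => mkQ_mem_adjoin_of_mem_lineGens xPi_mem_cellSpan (by rwa [evalQ_xPi])) hz

/-- Kontsevich–Zagier's `Z` lies in `M_π` (Theorem `kz_zeta_two`). -/
theorem of_zetaTwoRep_mem_piSector : of zetaTwoRep ∈ piSector := mkQ_zetaTwoRep_mem_adjoin

/-- The `ζ(2)`-ring lies in `M_π`. -/
theorem zetaTwoRing_le_piSector : zetaTwoRing ≤ piSector := by
  refine NonUnitalSubring.closure_le.mpr ?_
  rintro g (hg | hg)
  · exact lineRing_pi_le_piSector (NonUnitalSubring.subset_closure hg)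
  · rw [mem_singleton_iff] at hg
    rw [hg]
    exact of_zetaTwoRep_mem_piSector

/-- The unit-square representation `S` lies in `M_π`. -/
theorem of_unitSquareRep_mem_piSector : of unitSquareRep ∈ piSector := by
  rw [mem_piSector, mkQ_eq_mkQ_iff.mpr equivalent_unitSquare_zetaTwo]
  exact of_zetaTwoRep_mem_piSector

/-- **Kernel form: the Kontsevich–Zagier conjecture holds on the tame `π`-sector.**  An element of
`M_π` with period `0` is a relation (transcendence of `π` + the rank-one algebra of
`SoloBlindBoxRankOne`). -/
theorem piSector_kernel {z : FormalRep} (hz : z ∈ piSector) (h0 : eval z = 0) : z ∈ relations :=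
  mem_relations_of_mem_adjoin_singleton xPi_mem_cellSpan hz h0

/-- **The Kontsevich–Zagier conjecture on `M_π`.**  Two integral representations in the tame
`π`-sector — e.g. any products and `ℤ`-combinations of `Z`, `S`, and rational one-dimensional
integrals with values in `ℚ̄ + ℚ̄π` — are KZ-equivalent as soon as their periods agree. -/
theorem kz_piSector {n m : ℕ} (r : IntegralRep n) (r' : IntegralRep m) (hr : of r ∈ piSector)
    (hr' : of r' ∈ piSector) (hv : r.value = r'.value) : Equivalent r r' :=
  piSector_kernel (sub_mem hr hr') (by rw [map_sub, eval_of, eval_of, hv, sub_self])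

/-- Example: `S` is KZ-equivalent to every representation of `π²/6` in the rank-one ring `B(π)`. -/
theorem kz_zeta_two_square_of_mem_lineRing {m : ℕ} (r' : IntegralRep m)
    (hr' : of r' ∈ lineRing Real.pi) (hv : r'.value = Real.pi ^ 2 / 6) :
    Equivalent unitSquareRep r' :=
  kz_piSector _ _ of_unitSquareRep_mem_piSector (lineRing_pi_le_piSector hr')
    (by rw [unitSquareRep_value, hv])

/-- Example: `S × Z`-type products — `[S]·[P]` and `[Z]·[P]` (`P = [(0,∞), 1/(1+x²)]`), two
three-dimensional representations of `π³/12`, are KZ-equivalent. -/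
theorem kz_unitSquare_prod_arctan :
    Equivalent (unitSquareRep.prod arctanHalfLine) (zetaTwoRep.prod arctanHalfLine) := by
  have hP : of arctanHalfLine ∈ piSector :=
    lineRing_pi_le_piSector (NonUnitalSubring.subset_closure of_arctanHalfLine_mem_lineGens)
  refine kz_piSector _ _ ?_ ?_ ?_
  · rw [← of_mul_of]
    exact mul_mem of_unitSquareRep_mem_piSector hP
  · rw [← of_mul_of]
    exact mul_mem of_zetaTwoRep_mem_piSector hP
  · rw [IntegralRep.value_prod, IntegralRep.value_prod, unitSquareRep_value, zetaTwoRep_value]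

end SoloBlind

end Summit.KontsevichZagierPeriods.KontsevichZagierPeriods.Theorems
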